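import Summits.QuantumFields.YangMills.Theorems.BalabanUVNodesN06Row17LocalCentreOfLemma24Letter
import Literature.MathematicalPhysics.QuantumFieldTheory.Balaban1983to89.B9LocalLemma24TwoLevelAtLettersY

/-!
# BalabanUVNodes ∕ N06 ([B9], `Dag.B9_main`) — ROW 17's LOCAL CENTRE NUMBER `m_□` AT AN INTERFACE (TWO-LEVEL) CUBE, `U = 1`: the `hco` binder of the local road with
# an EXPLICIT constant from dag-n10-c's TWO-LEVEL Lemma-2.4 letter (`B9LocalLemma24TwoLevelAtLettersY.local_lemma24_real_twoLevel`, ROAD «C» station C6) fed into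
# this seat's reduction `…LocalCentreOfLemma24Letter.coer_trIP_padDeltaALocY_one_of_lemma24_letter` (the class `𝒯ᵣ(D)` is level-blind)

Track A of `YM-PLAN.md` (cell `pub-ymgap`, HUMAN RULING D-0062), node **N06** = [Balaban1985BackgroundPropagators] Thms 3.1–3.15; seat `pub-ymgap-dag-n06-j`
(bundle F5, rows 15–17), g24.  A HELPER (count-neutral, `--supports` only).

THE PRINT.  [B9] p. 416: *«In [4] we have proved that the operator G_□(1) is positive»*; [4] = [Balaban1984PropagatorsII] (2.89)–(2.94) pp. 239–240 (the cube meeting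
`Ω_{j+1}`: the two-scale construction), Lemma 2.4 (2.128) p. 245.

WHAT.  ★★★ `coer_trIP_padDeltaALocY_one_of_twoLevel_letter`: at def-Y's letters, `U = 1`, for a cube site set `D` which is the union of the level-`j` member blocks of a
finite set `S ⊆ Λ_j` and the level-`(j+1)` member blocks of a finite set `T ⊆ Λ_{j+1}` carrying dag-n10-c's two-level cube data (`hST`, the label margins `hboxS`∕`hboxT`,
the index facts `hIS`∕`hIB`), weights `≥ w₀ > 0`, 0∕1 cuts `χP`, `χ` with `χ` issuing from `D`:
**`min 1 γ₂ · ⟨Ψ,Ψ⟩₁ ≤ ⟨Ψ, padDeltaALocY i parSymY parBY D (cutMulY χP) (cutMulY χ) 1 Ψ⟩₁` for EVERY `Ψ`**, `γ₂ = (2∕κ₂ + (4∕π)(1 + 4(d+1)c_f²∕κ₂))⁻¹` with the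
two-level constant `κ₂ = (12(d+1)²(1 + 12(d+1)L^{2j}))⁻¹((L^{j+1})^{d+2})⁻¹·min(c_f²∕2, w₀∕(L^{j+1})^{d−1})` and `π = 8c_f²∕L^{2k}`.  The member-block dichotomy `hD` of
the reduction is DERIVED from the `S`∕`T` description of `D` by the partition uniqueness (2.4) (`Domains.lamSite_iterBlockOf_unique`).
HONEST FRAMING.  A composition; the two-level cube data (`S`, `T`, margins, index facts) DISPLAYED as in the letter; nothing of [B9]'s or [4]'s estimates asserted beyond the
landed kernel theorems; COUNT-NEUTRAL; N06 ∕ N10 NOT discharged; nothing continuum ∕ OS ∕ mass gap ∕ Clay.  0 `def`, 0 `sorry`.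
-/

noncomputable section

namespace Summit.QuantumFields.YangMills.BalabanUVNodes.N06Row17LocalCentreTwoLevel

open Literature.MathematicalPhysics.QuantumFieldTheory.Balaban1983to89
open Literature.MathematicalPhysics.QuantumFieldTheory.Balaban1983to89.Node00
open Literature.MathematicalPhysics.QuantumFieldTheory.Balaban1983to89.Node00.OpsYDeltaALocal (padDeltaALocY)
open Literature.MathematicalPhysics.QuantumFieldTheory.Balaban1983to89.B9Thm311ReadingCoords (trIP)
open Literature.MathematicalPhysics.QuantumFieldTheory.Balaban1983to89.B9Thm37CubeCoverCommutators (cutMulY)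
open Literature.MathematicalPhysics.QuantumFieldTheory.Balaban1983to89.B6KLevelCensusIndexV1 (KIdx)
open Literature.MathematicalPhysics.QuantumFieldTheory.Balaban1983to89.B6GlobalChartV1 (PV domT)
open Literature.MathematicalPhysics.QuantumFieldTheory.Balaban1983to89.B5Eq118OneStroke (iterBlock iterBlockOf mem_iterBlock)
open Literature.MathematicalPhysics.QuantumFieldTheory.Balaban1983to89.B9LocalLemma24TwoLevelAtLettersY (local_lemma24_real_twoLevel local_lemma24_twoLevel_const_pos)
open Literature.MathematicalPhysics.QuantumFieldTheory.Balaban1983to89.Node00.OpsYNablaBridge (chartY)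
open Summit.QuantumFields.YangMills.BalabanUVNodes.N06Row17LocalCentreOfLemma24 (coer_trIP_padDeltaALocY_one_of_lemma24_letter)
open scoped Matrix
open scoped Matrix.Norms.L2Operator

variable {N : ℕ} {d ℓ : ℕ} {hd : 1 ≤ d + 1} {hL : Odd (ℓ + 1) ∧ 1 < ℓ + 1} {b₀ b₁ : ℝ} (i : KIdx d ℓ hd hL b₀ b₁)

/-- **THE MEMBER-BLOCK DICHOTOMY OF A TWO-LEVEL CUBE SITE SET**: if `D` consists of the sites of the member blocks `B^j(y)`, `y ∈ S ⊆ Λ_j`, and `B^{j+1}(Y)`, `Y ∈ T ⊆ Λ_{j+1}`,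
then every member block lies inside or outside `D` (the partition (2.4): a fine site lies over exactly one `Λ`-block). [cite: Balaban1984PropagatorsII, (2.4) p.224, (2.89) p.239] -/
theorem dichotomy_of_blocks {j : ℕ} (S : Finset (Site (PV d ℓ i.m i.K hd hL) j)) (T : Finset (Site (PV d ℓ i.m i.K hd hL) (j + 1)))
    (hSLam : ∀ y ∈ S, (domT i.hN i.D i.hk).LamSite j y) (hTLam : ∀ Y ∈ T, (domT i.hN i.D i.hk).LamSite (j + 1) Y)
    (D : Finset (SiteY i)) (hDS : ∀ y ∈ S, ∀ x ∈ iterBlock j y, chartY i x ∈ D) (hDT : ∀ Y ∈ T, ∀ x ∈ iterBlock (j + 1) Y, chartY i x ∈ D)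
    (hDsub : ∀ x : Site (PV d ℓ i.m i.K hd hL) 0, chartY i x ∈ D → (∃ y ∈ S, x ∈ iterBlock j y) ∨ (∃ Y ∈ T, x ∈ iterBlock (j + 1) Y)) :
    ∀ (j' : ℕ) (y' : Site (PV d ℓ i.m i.K hd hL) j'), (domT i.hN i.D i.hk).LamSite j' y' →
      (∀ x ∈ iterBlock j' y', chartY i x ∈ D) ∨ (∀ x ∈ iterBlock j' y', chartY i x ∉ D) := by
  intro j' y' hy'
  by_cases h : ∃ x₁ ∈ iterBlock j' y', chartY i x₁ ∈ D
  · obtain ⟨x₁, hx₁, hD₁⟩ := h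
    have hy'x : iterBlockOf j' x₁ = y' := (mem_iterBlock j' y' x₁).1 hx₁
    have hlam' : (domT i.hN i.D i.hk).LamSite j' (iterBlockOf j' x₁) := by rw [hy'x]; exact hy'
    left
    rcases hDsub x₁ hD₁ with ⟨y, hyS, hxy⟩ | ⟨Y, hYT, hxY⟩
    · have hyx : iterBlockOf j x₁ = y := (mem_iterBlock j y x₁).1 hxy
      have hlam : (domT i.hN i.D i.hk).LamSite j (iterBlockOf j x₁) := by rw [hyx]; exact hSLam y hyS
      obtain rfl : j' = j := (domT i.hN i.D i.hk).lamSite_iterBlockOf_unique hlam' hlam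
      have hyy : y' = y := by rw [← hy'x, hyx]
      subst hyy
      exact hDS y' hyS
    · have hYx : iterBlockOf (j + 1) x₁ = Y := (mem_iterBlock (j + 1) Y x₁).1 hxY
      have hlam : (domT i.hN i.D i.hk).LamSite (j + 1) (iterBlockOf (j + 1) x₁) := by rw [hYx]; exact hTLam Y hYT
      obtain rfl : j' = j + 1 := (domT i.hN i.D i.hk).lamSite_iterBlockOf_unique hlam' hlam
      have hyy : y' = Y := by rw [← hy'x, hYx]
      subst hyy
      exact hDT y' hYT
  · push Not at h
    exact Or.inr h

/-- ★★★ **ROW 17's LOCAL CENTRE NUMBER AT AN INTERFACE (TWO-LEVEL) CUBE, `U = 1`.**  At def-Y's letters, for dag-n10-c's two-level cube data (`S ⊆ Λ_j`, `T ⊆ Λ_{j+1}`,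
`hST`, label margins `hboxS`∕`hboxT`, index facts `hIS`∕`hIB`), `D` = the sites of the blocks of `S` and `T`, weights `≥ w₀ > 0`, 0∕1 cuts with `χ` issuing from `D`:
**`min 1 γ₂ · ⟨Ψ,Ψ⟩₁ ≤ ⟨Ψ, padDeltaALocY i parSymY parBY D (cutMulY χP) (cutMulY χ) 1 Ψ⟩₁` for every `Ψ`**, `γ₂` from the two-level `κ₂` and `π = 8c_f²∕L^{2k}` —
`coer_trIP_padDeltaALocY_one_of_lemma24_letter` ∘ `local_lemma24_real_twoLevel`. [cite: Balaban1985BackgroundPropagators, Thm 3.11 proof p.416, Cor. 3.6 p.408, pp.408–409; Balaban1984PropagatorsII, (2.89)–(2.94) pp.239–240, Lemma 2.4 (2.128) p.245, (2.11) p.225, (2.7) p.224] -/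
theorem coer_trIP_padDeltaALocY_one_of_twoLevel_letter (hd2 : 2 ≤ d + 1) {j : ℕ} (hjk : j + 1 ≤ (domT i.hN i.D i.hk).k)
    (S : Finset (Site (PV d ℓ i.m i.K hd hL) j)) (T : Finset (Site (PV d ℓ i.m i.K hd hL) (j + 1)))
    (hST : ∀ y ∈ S, blockOf y ∉ T)
    (hboxS : ∀ y ∈ S, ∀ μ, (ℓ + 1) ^ (j + 1) ≤ (y μ).val * (ℓ + 1) ^ j ∧
      (y μ).val * (ℓ + 1) ^ j + (ℓ + 1) ^ j + (ℓ + 1) ^ (j + 1) ≤ (PV d ℓ i.m i.K hd hL).sitesPerDir 0)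
    (hboxT : ∀ Y ∈ T, ∀ μ, (ℓ + 1) ^ (j + 1) ≤ (Y μ).val * (ℓ + 1) ^ (j + 1) ∧
      (Y μ).val * (ℓ + 1) ^ (j + 1) + 2 * (ℓ + 1) ^ (j + 1) ≤ (PV d ℓ i.m i.K hd hL).sitesPerDir 0)
    (hIS : ∀ bb : PBond (PV d ℓ i.m i.K hd hL) j, (bb.src ∈ S ∨ bb.tgt ∈ S) → blockOf bb.src ∉ T → blockOf bb.tgt ∉ T →
      (domT i.hN i.D i.hk).LamBond j bb)
    (hIB : ∀ BB : PBond (PV d ℓ i.m i.K hd hL) (j + 1), (BB.src ∈ T ∨ BB.tgt ∈ T) → (domT i.hN i.D i.hk).LamBond (j + 1) BB)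
    (hSLam : ∀ y ∈ S, (domT i.hN i.D i.hk).LamSite j y) (hTLam : ∀ Y ∈ T, (domT i.hN i.D i.hk).LamSite (j + 1) Y)
    (D : Finset (SiteY i)) (hDS : ∀ y ∈ S, ∀ x ∈ iterBlock j y, chartY i x ∈ D) (hDT : ∀ Y ∈ T, ∀ x ∈ iterBlock (j + 1) Y, chartY i x ∈ D)
    (hDsub : ∀ x : Site (PV d ℓ i.m i.K hd hL) 0, chartY i x ∈ D → (∃ y ∈ S, x ∈ iterBlock j y) ∨ (∃ Y ∈ T, x ∈ iterBlock (j + 1) Y))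
    {w₀ : ℝ} (hw₀ : 0 < w₀) (hw : ∀ ι : IBondY i, w₀ ≤ i.w ι)
    {χP : BlkY i → ℝ} (hχP : ∀ y, χP y = 0 ∨ χP y = 1) {χ : FBondY i → ℝ} (hχ : ∀ b, χ b = 0 ∨ χ b = 1)
    (hχD : ∀ b, χ b ≠ 0 → chartY i b.src ∈ D) (Ψ : FBondY i → Matrix (Fin N) (Fin N) ℂ) :
    min 1 (2 / ((12 * (((d + 1 : ℕ) : ℝ)) ^ 2 * (1 + 12 * (((d + 1 : ℕ) : ℝ)) * ((((ℓ + 1 : ℕ) : ℝ)) ^ j) ^ 2))⁻¹ *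
              (((((ℓ + 1 : ℕ) : ℝ)) ^ (j + 1)) ^ (d + 1 + 1))⁻¹ * min (i.cf ^ 2 / 2) (w₀ / ((((ℓ + 1 : ℕ) : ℝ)) ^ (j + 1)) ^ (d + 1 - 2))) +
          4 / (8 * i.cf ^ 2 / ((((ℓ + 1 : ℕ) : ℝ)) ^ i.k) ^ 2) *
            (1 + 4 * ((d + 1 : ℕ) : ℝ) * i.cf ^ 2 /
              ((12 * (((d + 1 : ℕ) : ℝ)) ^ 2 * (1 + 12 * (((d + 1 : ℕ) : ℝ)) * ((((ℓ + 1 : ℕ) : ℝ)) ^ j) ^ 2))⁻¹ *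
                (((((ℓ + 1 : ℕ) : ℝ)) ^ (j + 1)) ^ (d + 1 + 1))⁻¹ * min (i.cf ^ 2 / 2) (w₀ / ((((ℓ + 1 : ℕ) : ℝ)) ^ (j + 1)) ^ (d + 1 - 2)))))⁻¹ *
        trIP (fun _ => (1 : ℝ)) Ψ Ψ ≤
      trIP (fun _ => (1 : ℝ)) Ψ
        (padDeltaALocY i (parSymY i) (parBY i) D (cutMulY χP) (cutMulY χ) (fun _ _ => 1 : CfgY (Matrix (Fin N) (Fin N) ℂ) i) Ψ) := by
  refine coer_trIP_padDeltaALocY_one_of_lemma24_letter i D (dichotomy_of_blocks i S T hSLam hTLam D hDS hDT hDsub) hχP hχ hχD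
    (local_lemma24_twoLevel_const_pos i j hw₀) (fun v hst hoff => ?_) Ψ
  refine local_lemma24_real_twoLevel i hd2 hjk S T hST hboxS hboxT hIS hIB hw₀ hw v (fun b hb => ?_) (fun y hy x hx => ?_) (fun Y hY x hx => ?_)
  · -- a bond carrying `v` has an end point in `D`, hence in a block of `S` or of `T`
    by_cases hs : chartY i b.src ∈ D
    · rcases hDsub _ hs with ⟨y, hy, hxy⟩ | ⟨Y, hY, hxY⟩
      · exact Or.inl ⟨y, hy, Or.inl hxy⟩
      · exact Or.inr ⟨Y, hY, Or.inl hxY⟩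
    · by_cases ht : chartY i b.tgt ∈ D
      · rcases hDsub _ ht with ⟨y, hy, hxy⟩ | ⟨Y, hY, hxY⟩
        · exact Or.inl ⟨y, hy, Or.inr hxy⟩
        · exact Or.inr ⟨Y, hY, Or.inr hxY⟩
      · exact absurd (hoff b hs ht) hb
  · exact hst j y (hSLam y hy) (hDS y hy) x hx
  · exact hst (j + 1) Y (hTLam Y hY) (hDT Y hY) x hx

end Summit.QuantumFields.YangMills.BalabanUVNodes.N06Row17LocalCentreTwoLevel

end
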